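import Summits.ABC.ABC.Theses.IsogenyGlueCongruence
import Summits.ABC.ABC.Theorems.PolyHeightOfBoundedPrimes.Negative.ArchimedeanFloor

/-!
# `PolyHeightOfBoundedPrimes` (stmt-ABC-16006, crux B') — floor of the "Hall half"
`|c₄|³ ≤ C·|Δ_min|^{σ'}`: no exponent `σ' < 3/2`, already on Frey curves

Negative support (cdisprove seat `refuter-cdisprove-stmt-ABC-16006-0`, cycle 1, 2026-08-16).
Card `archimedean-hall-split` (crux-ideate r1) splits the consequent `H` of B' into a finite half
`PolySzpiroΔ : |Δ_min| ≤ C·N^σ` and an archimedean / Hall half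
`PolyHallΔ : ∃ σ' C, 0 ≤ σ' ∧ ∀ W, |c₄(W)|³ ≤ C·|Δ_W|^{σ'}` over semistable global minimal elliptic
`W/ℚ`, predicting `σ' ≥ 6` from Danilov's Fermat–Pell family (if realised by semistable curves).
Kernel-checked here: the UNCONDITIONAL floor `σ' ≥ 3/2`, realised by the simplest Frey family
`y² = x(x + 1)(x + 32k)` (`a = −1`, `b = 32k`, Serre's normalisation): on its global minimal model
`|c₄|³ = (1 − b + b²)³ ≍ b⁶` while `|Δ_min| = (b(b−1))²/2⁸ ≍ b⁴`.

* `exists_globallyMinimal_model_scaling` — global minimal model with the scaling `u` exposed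
  (`c₄ ↦ u⁴c₄`, `Δ ↦ u¹²Δ`), so that `|c₄|³/|Δ|` (= `|j|`) is transported exactly;
* `exists_frey_hall_gt`, `not_polyHallAt_of_lt_three_halves`, `three_halves_le_of_polyHallAt` —
  for `0 ≤ σ' < 3/2` and every `C` a semistable global minimal elliptic `W` with
  `C·|Δ_W|^{σ'} < |c₄(W)|³`; any witness exponent of the Hall half is `≥ 3/2`.

(Frey curves cannot see beyond `3/2`: on them `|c₄|³ ≤ 2¹⁴·|Δ_min|^{3/2}` — the card's remark that
Frey-scoped routes never meet the Hall half; the conjectural floor `6` needs non-Frey families.)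
No Theses statement is asserted.
-/

noncomputable section

-- `Summit.<Summit>.<Problem>`: for the single-conjunct summit `ABC` the duplicate `ABC.ABC` is mandated.
set_option linter.dupNamespace false

open Summit.ABC.ABC.Theses.IsogenyGlueCongruence
open WeierstrassCurve IsDedekindDomain
open Literature.NumberTheory.EllipticCurves

namespace Summit.ABC.ABC.Theorems.PolyHeightOfBoundedPrimes.Negative

/-- **Global minimal model, scaling exposed.** Every elliptic `W/ℚ` has a globally minimal model `W₁`
with the same conductor, `|Δ_{W₁}| = |Δ_min(W)|`, semistable if `W` is, and `c₄(W₁) = u⁴c₄(W)`,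
`Δ(W₁) = u¹²Δ(W)` for some `u ≠ 0` (Silverman AEC III Table 3.1). [cite: SilvermanAEC2009, VIII.8 Cor. 8.3] -/
theorem exists_globallyMinimal_model_scaling (W : WeierstrassCurve ℚ) [W.IsElliptic] :
    ∃ (W₁ : WeierstrassCurve ℚ) (u : ℚ), W₁.IsElliptic ∧ W₁.IsGloballyMinimal ∧
      (W.IsSemistable ℤ → W₁.IsSemistable ℤ) ∧ W₁.conductorNorm ℤ = W.conductorNorm ℤ ∧
      ((|W₁.Δ| : ℚ) : ℝ) = (W.minimalDiscriminantNorm ℤ : ℝ) ∧ u ≠ 0 ∧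
      W₁.c₄ = u ^ 4 * W.c₄ ∧ W₁.Δ = u ^ 12 * W.Δ := by
  obtain ⟨Cv, W₀, hCW, hmin⟩ := W.exists_baseChange_int_forall_isMinimalAt
  have hΔ0 : W₀.Δ ≠ 0 := by
    intro h0
    have h1 : (Cv • W).Δ = 0 := by
      simp [hCW, WeierstrassCurve.baseChange, WeierstrassCurve.map_Δ, h0]
    exact (Cv • W).isUnit_Δ.ne_zero h1
  haveI hE₁ : (W₀.baseChange ℚ).IsElliptic := isElliptic_baseChange_int W₀ hΔ0
  haveI hM₁ : (W₀.baseChange ℚ).IsGloballyMinimal :=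
    isGloballyMinimal_of_forall_isMinimalAt_int _ hmin
  refine ⟨W₀.baseChange ℚ, ((Cv.u⁻¹ : ℚˣ) : ℚ), hE₁, hM₁, fun hss => ?_, ?_, ?_, Units.ne_zero _, ?_, ?_⟩
  · rw [← hCW]
    exact (isSemistable_smul_iff_holds ℤ W Cv).mpr hss
  · rw [← hCW, conductorNorm_smul_rat]
  · have hD₁ : W.minimalDiscriminantNorm ℤ = W₀.Δ.natAbs := by
      rw [← minimalDiscriminantNorm_smul_rat W Cv, hCW,
        minimalDiscriminantNorm_eq_natAbs_holds W₀ hΔ0 hmin]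
    have hΔ : (W₀.baseChange ℚ).Δ = (W₀.Δ : ℚ) := by
      simp [WeierstrassCurve.baseChange, WeierstrassCurve.map_Δ]
    rw [hD₁, hΔ, Nat.cast_natAbs]
    push_cast
    rfl
  · rw [← hCW, variableChange_c₄]
  · rw [← hCW, variableChange_Δ]

/-- **Witness form: Frey curves beat every Hall exponent below `3/2`.** For `0 ≤ σ < 3/2` and every
`C` there is a semistable elliptic `W/ℚ` in global minimal form with `C·|Δ_W|^σ < |c₄(W)|³` — the
global minimal model of `y² = x(x+1)(x+b)`, `b = 32k`: `|c₄|³ = (1 − b + b²)³ ≥ b⁶/8`,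
`|Δ| = (b(b−1))²/2⁸ ≤ b⁴`. [cite: Frey1986] -/
theorem exists_frey_hall_gt {σ : ℝ} (hσ0 : 0 ≤ σ) (hσ : σ < 3 / 2) (C : ℝ) :
    ∃ W : WeierstrassCurve ℚ, W.IsElliptic ∧ W.IsGloballyMinimal ∧ W.IsSemistable ℤ ∧
      0 < W.conductorNorm ℤ ∧
      C * ((|W.Δ| : ℚ) : ℝ) ^ σ < ((|W.c₄| ^ 3 : ℚ) : ℝ) := by
  -- threshold: `b^e > 8M`, `e = 6 − 4σ`
  set M : ℝ := max C 1 with hM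
  have hM1 : 1 ≤ M := le_max_right _ _
  have hM0 : 0 < M := by linarith
  set e : ℝ := 6 - 4 * σ with he
  have he0 : 0 < e := by rw [he]; linarith
  have heσ : e + 4 * σ = 6 := by rw [he]; ring
  set T : ℝ := (8 * M) ^ e⁻¹ with hT
  have hT0 : 0 ≤ T := Real.rpow_nonneg (by linarith) _
  set k : ℕ := ⌈T⌉₊ + 1 with hk
  have hk1 : 1 ≤ k := by omega
  set b : ℤ := 32 * k with hb
  have hb32 : (32 : ℤ) ≤ b := by rw [hb]; exact_mod_cast Nat.mul_le_mul_left 32 hk1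
  -- Frey data for `(a, b) = (−1, 32k)`
  have h0 : (-1 : ℤ) * b * (-1 + b) ≠ 0 := by
    have : (0 : ℤ) < b * (b - 1) := by nlinarith
    intro h; nlinarith
  have hcop : IsCoprime (-1 : ℤ) b := isCoprime_one_left.neg_left
  have hA : (-1 : ℤ) ≡ -1 [ZMOD 4] := Int.ModEq.refl _
  have hB : (32 : ℤ) ∣ b := ⟨k, by rw [hb]⟩
  haveI hW : (freyCurve (-1) b).IsElliptic := isElliptic_freyCurve h0
  have hss : (freyCurve (-1) b).IsSemistable ℤ := isSemistable_freyCurve_of_mod_holds (-1) b hcop h0 hA hB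
  have hD : 2 ^ 8 * (freyCurve (-1) b).minimalDiscriminantNorm ℤ = (((-1 : ℤ) * b * (-1 + b)) ^ 2).natAbs :=
    minimalDiscriminantNorm_freyCurve_of_mod_holds (-1) b hcop h0 hA hB
  obtain ⟨W₁, u, hE₁, hM₁, hss₁, hN₁, hΔ₁, hu, hc₄, hΔu⟩ :=
    exists_globallyMinimal_model_scaling (freyCurve (-1) b)
  refine ⟨W₁, hE₁, hM₁, hss₁ hss, by rw [hN₁]; exact (freyCurve (-1) b).conductorNorm_pos_holds, ?_⟩
  -- exact invariants of the minimal model: `|Δ₁| = (b(b−1))²/256`, `|c₄(W₁)|³ = (1 − b + b²)³`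
  set D : ℕ := (freyCurve (-1) b).minimalDiscriminantNorm ℤ with hDdef
  have hΔ₁q : (|W₁.Δ| : ℚ) = (D : ℚ) := by exact_mod_cast hΔ₁
  have hDq : (256 : ℚ) * (D : ℚ) = ((b : ℚ) * ((b : ℚ) - 1)) ^ 2 := by
    have h := congrArg (fun n : ℕ ↦ (n : ℚ)) hD
    simp only [Nat.cast_mul, Nat.cast_pow, Nat.cast_ofNat, Nat.cast_natAbs] at h
    rw [show ((2 : ℚ) ^ 8) = 256 by norm_num] at h
    rw [h]
    push_cast
    rw [abs_of_nonneg (sq_nonneg _)]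
    ring
  have hcW : (freyCurve (-1) b).c₄ = 16 * (1 - (b : ℚ) + (b : ℚ) ^ 2) := by
    rw [freyCurve_c₄]; push_cast; ring
  have hΔW : (freyCurve (-1) b).Δ = 16 * ((b : ℚ) * ((b : ℚ) - 1)) ^ 2 := by
    rw [freyCurve_Δ]; push_cast; ring
  have hbq : (32 : ℚ) ≤ b := by exact_mod_cast hb32
  have hP : (0 : ℚ) < (b : ℚ) * ((b : ℚ) - 1) := by nlinarith
  have hQ : (0 : ℚ) < 1 - (b : ℚ) + (b : ℚ) ^ 2 := by nlinarith
  have hX : |W₁.c₄| ^ 3 = (1 - (b : ℚ) + (b : ℚ) ^ 2) ^ 3 := by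
    -- `|c₄(W₁)|³ · |Δ(W)| = |Δ(W₁)| · |c₄(W)|³` (both are `|u|¹² |c₄(W)|³ |Δ(W)|`)
    have hI : |W₁.c₄| ^ 3 * |(freyCurve (-1) b).Δ| = |W₁.Δ| * |(freyCurve (-1) b).c₄| ^ 3 := by
      rw [hc₄, hΔu]
      simp only [abs_mul, abs_pow]
      ring
    have h1 : |(freyCurve (-1) b).Δ| = 16 * ((b : ℚ) * ((b : ℚ) - 1)) ^ 2 := by
      rw [hΔW, abs_of_pos (mul_pos (by norm_num) (pow_pos hP 2))]
    have h2 : |(freyCurve (-1) b).c₄| = 16 * (1 - (b : ℚ) + (b : ℚ) ^ 2) := by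
      rw [hcW, abs_of_pos (mul_pos (by norm_num) hQ)]
    have hD' : (D : ℚ) = ((b : ℚ) * ((b : ℚ) - 1)) ^ 2 / 256 := by
      rw [← hDq]; ring
    rw [h1, h2, hΔ₁q, hD'] at hI
    have hI' : |W₁.c₄| ^ 3 * (16 * ((b : ℚ) * ((b : ℚ) - 1)) ^ 2) =
        (1 - (b : ℚ) + (b : ℚ) ^ 2) ^ 3 * (16 * ((b : ℚ) * ((b : ℚ) - 1)) ^ 2) := by
      rw [hI]; ring
    exact mul_right_cancel₀ (mul_ne_zero (by norm_num) (pow_ne_zero 2 hP.ne')) hI'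
  -- pass to `ℝ`
  rw [hX, hΔ₁q]
  have hbr : (32 : ℝ) ≤ (b : ℝ) := by exact_mod_cast hb32
  have hbr0 : (0 : ℝ) < (b : ℝ) := by linarith
  have hDr : (256 : ℝ) * (D : ℝ) = ((b : ℝ) * ((b : ℝ) - 1)) ^ 2 := by exact_mod_cast hDq
  have hD0 : (0 : ℝ) ≤ (D : ℝ) := Nat.cast_nonneg _
  have hDle : (D : ℝ) ≤ (b : ℝ) ^ (4 : ℕ) := by
    have hP1 : ((b : ℝ) * ((b : ℝ) - 1)) ^ 2 ≤ ((b : ℝ) * (b : ℝ)) ^ 2 := by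
      apply pow_le_pow_left₀ (by nlinarith) (by nlinarith)
    nlinarith
  have hQr : (b : ℝ) ^ (6 : ℕ) / 8 ≤ (1 - (b : ℝ) + (b : ℝ) ^ 2) ^ 3 := by
    have hq : (b : ℝ) ^ 2 / 2 ≤ 1 - (b : ℝ) + (b : ℝ) ^ 2 := by nlinarith
    have hq0 : (0 : ℝ) ≤ (b : ℝ) ^ 2 / 2 := by positivity
    calc (b : ℝ) ^ (6 : ℕ) / 8 = ((b : ℝ) ^ 2 / 2) ^ 3 := by ring
      _ ≤ (1 - (b : ℝ) + (b : ℝ) ^ 2) ^ 3 := pow_le_pow_left₀ hq0 hq 3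
  -- `T < b`, so `8M < b^e`
  have hTk : T < (k : ℝ) := by
    have h1 : T ≤ (⌈T⌉₊ : ℝ) := Nat.le_ceil T
    have h2 : (⌈T⌉₊ : ℝ) < (k : ℝ) := by rw [hk]; push_cast; linarith
    exact h1.trans_lt h2
  have hkb : (k : ℝ) ≤ (b : ℝ) := by
    have : (k : ℤ) ≤ b := by rw [hb]; omega
    exact_mod_cast this
  have hTb : T < (b : ℝ) := hTk.trans_le hkb
  have hbe : 8 * M < (b : ℝ) ^ e := by
    have h := Real.rpow_lt_rpow hT0 hTb he0
    rwa [hT, Real.rpow_inv_rpow (by linarith) he0.ne'] at h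
  have hb4σ : (0 : ℝ) < (b : ℝ) ^ (4 * σ) := Real.rpow_pos_of_pos hbr0 _
  have hsplit : (b : ℝ) ^ (6 : ℕ) = (b : ℝ) ^ e * (b : ℝ) ^ (4 * σ) := by
    rw [← Real.rpow_add hbr0, heσ]
    norm_cast
  have hpow4 : ((b : ℝ) ^ (4 : ℕ)) ^ σ = (b : ℝ) ^ (4 * σ) := by
    rw [Real.rpow_mul hbr0.le]
    norm_cast
  -- the chain
  have hDσ : (D : ℝ) ^ σ ≤ (b : ℝ) ^ (4 * σ) := by
    rw [← hpow4]
    exact Real.rpow_le_rpow hD0 hDle hσ0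
  have hDσ0 : (0 : ℝ) ≤ (D : ℝ) ^ σ := Real.rpow_nonneg hD0 σ
  push_cast
  calc C * (D : ℝ) ^ σ ≤ M * (D : ℝ) ^ σ := mul_le_mul_of_nonneg_right (le_max_left _ _) hDσ0
    _ ≤ M * (b : ℝ) ^ (4 * σ) := mul_le_mul_of_nonneg_left hDσ hM0.le
    _ < (b : ℝ) ^ e * (b : ℝ) ^ (4 * σ) / 8 := by
        rw [lt_div_iff₀ (by norm_num : (0 : ℝ) < 8)]
        nlinarith [mul_lt_mul_of_pos_right hbe hb4σ]
    _ = (b : ℝ) ^ (6 : ℕ) / 8 := by rw [hsplit]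
    _ ≤ (1 - (b : ℝ) + (b : ℝ) ^ 2) ^ 3 := hQr

/-- **Floor of the Hall half.** For no `σ ∈ [0, 3/2)` is there a constant `C` with
`|c₄(W)|³ ≤ C·|Δ_W|^σ` for every semistable elliptic `W/ℚ` in global minimal form (witness: the
Frey family `y² = x(x+1)(x+32k)`). Any archimedean / Hall engine for B' must deliver an exponent
`σ' ≥ 3/2` in `|Δ_min|` (conjecturally `≥ 6`, Danilov). [cite: Frey1986] -/
theorem not_polyHallAt_of_lt_three_halves {σ : ℝ} (hσ0 : 0 ≤ σ) (hσ : σ < 3 / 2) :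
    ¬ ∃ C : ℝ, ∀ (W : WeierstrassCurve ℚ) [W.IsElliptic] [W.IsGloballyMinimal]
      [NeZero (W.conductorNorm ℤ)], W.IsSemistable ℤ →
        ((|W.c₄| ^ 3 : ℚ) : ℝ) ≤ C * ((|W.Δ| : ℚ) : ℝ) ^ σ := by
  rintro ⟨C, hC⟩
  obtain ⟨W, hE, hM, hss, hN, hlt⟩ := exists_frey_hall_gt hσ0 hσ C
  haveI := hE
  haveI := hM
  haveI : NeZero (W.conductorNorm ℤ) := ⟨hN.ne'⟩
  exact absurd (hC W hss) (not_le.mpr hlt)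

/-- **Any witness of the Hall half `PolyHallΔ` (card archimedean-hall-split: `0 ≤ σ'` and
`|c₄|³ ≤ C·|Δ|^{σ'}` on all semistable global minimal elliptic `W/ℚ`) has `3/2 ≤ σ'`.**
[cite: Frey1986] -/
theorem three_halves_le_of_polyHallAt {σ C : ℝ} (hσ0 : 0 ≤ σ)
    (h : ∀ (W : WeierstrassCurve ℚ) [W.IsElliptic] [W.IsGloballyMinimal]
      [NeZero (W.conductorNorm ℤ)], W.IsSemistable ℤ →
        ((|W.c₄| ^ 3 : ℚ) : ℝ) ≤ C * ((|W.Δ| : ℚ) : ℝ) ^ σ) : 3 / 2 ≤ σ :=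
  not_lt.mp fun hσ => not_polyHallAt_of_lt_three_halves hσ0 hσ ⟨C, fun W _ _ _ hW => h W hW⟩

end Summit.ABC.ABC.Theorems.PolyHeightOfBoundedPrimes.Negative

end
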